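import Mathlib
import Summits.CriticalPhenomena.CardyFormulaZ2.Theorems.CardySelfRefinementGradientComparabilityStubLevelSetTransport
import HarnessLib

/-!
# Crux `GradientComparability` (stmt-CriticalPhenomena-10269), line `monotone-product-coordinates`:
# the level-set transport from the POINTWISE corner BET (W)

Route `CardySelfRefinement`, sub-problem `CriticalPhenomena/CardyFormulaZ2`; vocabulary
(`P`, `Dρ`, `Dc`, `PathOK`, …) from `CardySelfRefinementDefs` (definitionally the route's
`let`-chain).

The landed `stub_levelSetTransport` (`…StubLevelSetTransport`) takes as its second hypothesis the
registered corner BET (R): `Dρ ≠ 0` and `Dc/Dρ` `Θ`-Lipschitz in `ρ` between ANY two band points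
`(ρ, c)`, `(ρ', c)` of the corner strip.  Its corner half (`levelSetTransport_corner`) only ever
uses (R) pointwise: conjunct 1 at a band point, and conjunct 2 in an arbitrarily small left
neighbourhood of a band point, to bound the derivative of `r ↦ Dc(r,c)/Dρ(r,c)`.  The weakest
consumed form is therefore the POINTWISE corner BET

  (W)  at every band point `(ρ, c)` of the strip `[1-2δ, 1] × [0, 1]`: `Dρ ≠ 0`, and every
       within-`[0,1]` derivative `S'` of `r ↦ Dc(r,c)/Dρ(r,c)` at `ρ` has `|S'| ≤ Θ`,

mesh-uniformly on each level band.  (R) ⇒ (W) (with `δ_W := δ_R/2`); (W) ⇏ (R) in general, since (R)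
also compares two band points whose connecting segment may leave the band.

* `levelSetTransport_corner_of_pointwise`: (W) and the corner patch imply the corner clause of the
  level-set comparability, for the depth `δ` OF (W) itself (no band widening, no halving of `δ`):
  the landed proof of `levelSetTransport_corner` with the left-Lipschitz step replaced by a
  congruence (`HasDerivAt → HasDerivWithinAt` on `[0,1]`; `Dρ`, `Dc` are the partials of the
  polynomial `Φ` of `exists_contDiff_two_eq_P` on the square), then `corner_endpoint` twice and
  the patch between the two slice endpoints; constant `e^Θ · max Λ_P 0 · e^Θ`.
* `stub_levelSetTransport_of_pointwiseCornerBet` (registered): THE BET → (W) → corner patch →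
  level-set comparability; bulk half = the landed `levelSetTransport_bulk`.
-/

noncomputable section

namespace Summit.CriticalPhenomena.CardyFormulaZ2.Theorems.CardySelfRefinement

open scoped Topology
open Filter Set MeasureTheory
open Literature.Probability.LatticeModels Literature.Probability.Percolation
open Literature.Probability.Percolation.QuadCrossing
open Summit.CriticalPhenomena.CardyFormulaZ2.Theses.CardySelfRefinement

/-- **Corner transport from the pointwise corner BET (W).**  (W) and the corner patch imply: for
the depth `δ` OF (W) itself, same-level band points of `[1-2δ, 1] × [0,1]` have comparable `|Dρ|`,
mesh-uniformly (constant `e^Θ · max Λ_P 0 · e^Θ`). -/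
theorem levelSetTransport_corner_of_pointwise
    (hCBW : ∀ k : ℕ, k = 2 ∨ k = 3 → ∀ γ : unitInterval → ℝ × ℝ, PathOK k γ →
      ∀ (m : ℕ) (F : Fin m → Quad (Set.univ : Set ℂ)), 0 < m →
        ∃ δ : ℝ, 0 < δ ∧ δ ≤ 1 / 4 ∧ ∀ vlo vhi : ℝ, 0 < vlo → vlo < vhi → vhi < 1 →
          ∃ Θ η₁ : ℝ, 0 ≤ Θ ∧ 0 < η₁ ∧ ∀ η ∈ Set.Ioo 0 η₁, ∀ c ∈ Set.Icc (0 : ℝ) 1,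
            ∀ ρ ∈ Set.Icc (1 - 2 * δ) 1, P k m F η ρ c ∈ Set.Icc vlo vhi →
              Dρ k m F η (ρ, c) ≠ 0 ∧
              ∀ S' : ℝ, HasDerivWithinAt (fun r => Dc k m F η (r, c) / Dρ k m F η (r, c)) S'
                (Set.Icc 0 1) ρ → |S'| ≤ Θ)
    (hCP : ∀ k : ℕ, k = 2 ∨ k = 3 → ∀ (m : ℕ) (F : Fin m → Quad (Set.univ : Set ℂ)), 0 < m →
      ∀ vlo vhi : ℝ, 0 < vlo → vlo < vhi → vhi < 1 →
        ∃ Λ η₁ : ℝ, 0 < η₁ ∧ ∀ η ∈ Set.Ioo 0 η₁,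
          ∀ q ∈ Set.Icc (0 : ℝ) 1 ×ˢ Set.Icc (0 : ℝ) 1,
            ∀ q' ∈ Set.Icc (0 : ℝ) 1 ×ˢ Set.Icc (0 : ℝ) 1,
            (q.1 = 1 ∨ q.2 = 0) → (q'.1 = 1 ∨ q'.2 = 0) →
              P k m F η q.1 q.2 ∈ Set.Icc vlo vhi → P k m F η q'.1 q'.2 ∈ Set.Icc vlo vhi →
                |Dρ k m F η q| ≤ Λ * |Dρ k m F η q'|)
    (k : ℕ) (hk : k = 2 ∨ k = 3) (γ : unitInterval → ℝ × ℝ) (hγ : PathOK k γ)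
    (m : ℕ) (F : Fin m → Quad (Set.univ : Set ℂ)) (hm : 0 < m) :
    ∃ δ : ℝ, 0 < δ ∧ δ ≤ 1 / 4 ∧ ∀ vlo vhi : ℝ, 0 < vlo → vlo < vhi → vhi < 1 →
      ∃ Λ η₁ : ℝ, 0 < η₁ ∧ ∀ η ∈ Set.Ioo 0 η₁,
        ∀ ρ₀ ∈ Set.Icc (1 - 2 * δ) 1, ∀ c₀ ∈ Set.Icc (0 : ℝ) 1,
        ∀ ρ₁ ∈ Set.Icc (1 - 2 * δ) 1, ∀ c₁ ∈ Set.Icc (0 : ℝ) 1,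
          P k m F η ρ₀ c₀ ∈ Set.Icc vlo vhi → P k m F η ρ₁ c₁ = P k m F η ρ₀ c₀ →
            |Dρ k m F η (ρ₁, c₁)| ≤ Λ * |Dρ k m F η (ρ₀, c₀)| := by
  obtain ⟨δB, hδB, hδB4, hCB'⟩ := hCBW k hk γ hγ m F hm
  refine ⟨δB, hδB, hδB4, fun vlo vhi hvlo hvv hvhi => ?_⟩
  -- (W) on the band `[vlo, vhi]` itself, the patch on `[vlo, vhi]`, `P(ρ,1) = 1`
  obtain ⟨Θ, ηT, hΘ, hηT, hT⟩ := hCB' vlo vhi hvlo hvv hvhi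
  obtain ⟨ΛP, ηP, hηP, hPt⟩ := hCP k hk m F hm vlo vhi hvlo hvv hvhi
  obtain ⟨η₇, hη₇, hP1⟩ := P_one_eq_one_of_mem_Ioo hk m F
  refine ⟨Real.exp Θ * max ΛP 0 * Real.exp Θ, min ηT (min ηP η₇), lt_min hηT (lt_min hηP hη₇), ?_⟩
  intro η hη ρ₀ hρ₀ c₀ hc₀ ρ₁ hρ₁ c₁ hc₁ hband hlev
  have hηT' : η ∈ Set.Ioo 0 ηT := ⟨hη.1, lt_of_lt_of_le hη.2 (min_le_left _ _)⟩
  have hηP' : η ∈ Set.Ioo 0 ηP :=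
    ⟨hη.1, lt_of_lt_of_le hη.2 ((min_le_right _ _).trans (min_le_left _ _))⟩
  have hη7' : η ∈ Set.Ioo 0 η₇ :=
    ⟨hη.1, lt_of_lt_of_le hη.2 ((min_le_right _ _).trans (min_le_right _ _))⟩
  have hη0 : η ≠ 0 := hη.1.ne'
  set v := P k m F η ρ₀ c₀ with hv
  -- the polynomial `Φ` and its partials on the square
  obtain ⟨Φ, hΦ, hPΦ⟩ := exists_contDiff_two_eq_P k m F hη0
  have hΦd : Differentiable ℝ Φ := hΦ.differentiable (by norm_num)
  have hDρ : ∀ ρ ∈ Set.Icc (0 : ℝ) 1, ∀ c ∈ Set.Icc (0 : ℝ) 1,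
      Dρ k m F η (ρ, c) = fderiv ℝ Φ (ρ, c) (1, 0) := fun ρ hρ c hc =>
    derivWithin_eq_fderiv_fst (hΦd (ρ, c)) hρ (fun ρ' hρ' => hPΦ ρ' hρ' c hc)
  have hDc : ∀ ρ ∈ Set.Icc (0 : ℝ) 1, ∀ c ∈ Set.Icc (0 : ℝ) 1,
      Dc k m F η (ρ, c) = fderiv ℝ Φ (ρ, c) (0, 1) := fun ρ hρ c hc =>
    derivWithin_eq_fderiv_snd (hΦd (ρ, c)) hc (fun c' hc' => hPΦ ρ hρ c' hc')
  have hstrip : ∀ ρ ∈ Set.Icc (1 - 2 * δB) 1, ρ ∈ Set.Icc (0 : ℝ) 1 :=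
    fun ρ hρ => ⟨by linarith [hρ.1], hρ.2⟩
  -- `Φ_c = Dc ≥ 0` on the square (`P` is monotone in `c`)
  have hcnn : ∀ q : ℝ × ℝ, q.1 ∈ Set.Icc (0 : ℝ) 1 → q.2 ∈ Set.Icc (0 : ℝ) 1 →
      0 ≤ fderiv ℝ Φ q (0, 1) := by
    rintro ⟨ρ, c⟩ hρ hc
    rw [← hDc ρ hρ c hc]
    have hmono : Monotone fun c' => P k m F η ρ c' := fun a b h => P_mono_c k m F hη0 ρ h
    exact (hmono.monotoneOn _).derivWithin_nonneg
  -- (W) bounds `∂_ρ(Φ_c/Φ_ρ)` at the level-`v` points of the strip `[1-2δB, 1] × [0,1]`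
  have hS : ∀ q : ℝ × ℝ, q.1 ∈ Set.Icc (1 - 2 * δB) 1 → q.2 ∈ Set.Icc (0 : ℝ) 1 → Φ q = v →
      ∀ S' : ℝ, HasDerivAt (fun r => fderiv ℝ Φ (r, q.2) (0, 1) / fderiv ℝ Φ (r, q.2) (1, 0))
        S' q.1 → |S'| ≤ Θ := by
    rintro ⟨ρ, c⟩ hρ hc hqv S' hS'
    dsimp only at hρ hc hqv hS' ⊢
    have hρ01 := hstrip ρ hρ
    have hPρ : P k m F η ρ c ∈ Set.Icc vlo vhi := by
      rw [hPΦ ρ hρ01 c hc, hqv]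
      exact hband
    have hW : HasDerivWithinAt (fun r => Dc k m F η (r, c) / Dρ k m F η (r, c)) S'
        (Set.Icc 0 1) ρ :=
      hS'.hasDerivWithinAt.congr_of_mem (fun r hr => by rw [hDc r hr c hc, hDρ r hr c hc]) hρ01
    exact (hT η hηT' c hc ρ hρ hPρ).2 S' hW
  -- no level-`v` point on the top edge `c = 1` (`P(ρ,1) = 1 > vhi`)
  have htop : ∀ ρ ∈ Set.Icc (1 - 2 * δB) 1, Φ (ρ, 1) ≠ v := by
    intro ρ hρ h
    have h1 := hP1 η hη7' ρ
    rw [hPΦ ρ (hstrip ρ hρ) 1 ⟨zero_le_one, le_rfl⟩, h] at h1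
    linarith [hband.2]
  -- `Φ_ρ ≠ 0` at the level-`v` points of the strip (conjunct 1 of (W))
  have hne : ∀ ρ ∈ Set.Icc (1 - 2 * δB) 1, ∀ c ∈ Set.Icc (0 : ℝ) 1, P k m F η ρ c = v →
      fderiv ℝ Φ (ρ, c) (1, 0) ≠ 0 := by
    intro ρ hρ c hc hPv
    have hPb : P k m F η ρ c ∈ Set.Icc vlo vhi := by
      rw [hPv]
      exact hband
    have h := (hT η hηT' c hc ρ hρ hPb).1
    rwa [hDρ ρ (hstrip ρ hρ) c hc] at h
  -- the two endpoints on the slices `{ρ = 1} ∪ {c = 0}`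
  have hρlo : 0 < 1 - 2 * δB := by linarith
  obtain ⟨⟨e₀ρ, e₀c⟩, he₀ρ, he₀c, he₀s, he₀v, he₀1, he₀2⟩ := corner_endpoint hΦ hρlo hΘ hcnn hS
    htop (q₀ := (ρ₀, c₀)) hρ₀ hc₀ (by rw [← hPΦ ρ₀ (hstrip ρ₀ hρ₀) c₀ hc₀])
    (hne ρ₀ hρ₀ c₀ hc₀ rfl)
  obtain ⟨⟨e₁ρ, e₁c⟩, he₁ρ, he₁c, he₁s, he₁v, he₁1, he₁2⟩ := corner_endpoint hΦ hρlo hΘ hcnn hS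
    htop (q₀ := (ρ₁, c₁)) hρ₁ hc₁ (by rw [← hPΦ ρ₁ (hstrip ρ₁ hρ₁) c₁ hc₁]; exact hlev)
    (hne ρ₁ hρ₁ c₁ hc₁ hlev)
  dsimp only at he₀ρ he₀c he₀s he₀v he₀1 he₀2 he₁ρ he₁c he₁s he₁v he₁1 he₁2
  -- the patch compares the endpoints
  have hPe₀ : P k m F η e₀ρ e₀c ∈ Set.Icc vlo vhi := by
    rw [hPΦ e₀ρ (hstrip e₀ρ he₀ρ) e₀c he₀c, he₀v]
    exact hband
  have hPe₁ : P k m F η e₁ρ e₁c ∈ Set.Icc vlo vhi := by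
    rw [hPΦ e₁ρ (hstrip e₁ρ he₁ρ) e₁c he₁c, he₁v]
    exact hband
  have hpatch := hPt η hηP' (e₁ρ, e₁c) ⟨hstrip e₁ρ he₁ρ, he₁c⟩ (e₀ρ, e₀c)
    ⟨hstrip e₀ρ he₀ρ, he₀c⟩ he₁s he₀s hPe₁ hPe₀
  rw [hDρ e₁ρ (hstrip e₁ρ he₁ρ) e₁c he₁c, hDρ e₀ρ (hstrip e₀ρ he₀ρ) e₀c he₀c] at hpatch
  rw [hDρ ρ₁ (hstrip ρ₁ hρ₁) c₁ hc₁, hDρ ρ₀ (hstrip ρ₀ hρ₀) c₀ hc₀]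
  calc |fderiv ℝ Φ (ρ₁, c₁) (1, 0)| ≤ Real.exp Θ * |fderiv ℝ Φ (e₁ρ, e₁c) (1, 0)| := he₁1
    _ ≤ Real.exp Θ * (max ΛP 0 * |fderiv ℝ Φ (e₀ρ, e₀c) (1, 0)|) := by
        gcongr
        exact hpatch.trans (mul_le_mul_of_nonneg_right (le_max_left _ _) (abs_nonneg _))
    _ ≤ Real.exp Θ * (max ΛP 0 * (Real.exp Θ * |fderiv ℝ Φ (ρ₀, c₀) (1, 0)|)) := by
        gcongr
    _ = Real.exp Θ * max ΛP 0 * Real.exp Θ * |fderiv ℝ Φ (ρ₀, c₀) (1, 0)| := by ring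

/-- **Level-set transport from the pointwise corner BET (registered helper
`stub_levelSetTransport_of_pointwiseCornerBet`)** of line `monotone-product-coordinates` (crux
`GradientComparability`): THE BET, the POINTWISE corner BET (W) and the corner patch imply the
LEVEL-SET COMPARABILITY of the Russo gradient — two band points of `[0,1-δ] × [0,1]` on the same
level have comparable `Dc` (bulk: the landed `levelSetTransport_bulk`), and for the depth `δ` of (W)
two band points of `[1-2δ,1] × [0,1]` on the same level have comparable `|Dρ|` (corner:
`levelSetTransport_corner_of_pointwise`), mesh-uniformly.  Same type as the landed
`stub_levelSetTransport` with its second hypothesis (the registered corner BET) replaced by (W). -/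
theorem stub_levelSetTransport_of_pointwiseCornerBet :
    (∀ k : ℕ, k = 2 ∨ k = 3 → ∀ γ : unitInterval → ℝ × ℝ, PathOK k γ → ∀ (m : ℕ) (F : Fin m → Quad
    (Set.univ : Set ℂ)), 0 < m → ∀ δ : ℝ, 0 < δ → δ ≤ 1 / 2 → ∀ vlo vhi : ℝ, 0 < vlo → vlo < vhi →
    vhi < 1 → ∃ Θ η₁ : ℝ, 0 ≤ Θ ∧ 0 < η₁ ∧ ∀ η ∈ Set.Ioo 0 η₁, ∀ ρ ∈ Set.Icc (0 : ℝ) (1 - δ), ∀ c ∈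
    Set.Icc (0 : ℝ) 1, ∀ c' ∈ Set.Icc (0 : ℝ) 1, P k m F η ρ c ∈ Set.Icc vlo vhi → P k m F η ρ c' ∈
    Set.Icc vlo vhi → |Dρ k m F η (ρ, c) / Dc k m F η (ρ, c) - Dρ k m F η (ρ, c') / Dc k m F η (ρ,
    c')| ≤ Θ * |c - c'|) → (∀ k : ℕ, k = 2 ∨ k = 3 → ∀ γ : unitInterval → ℝ × ℝ, PathOK k γ → ∀ (m :
    ℕ) (F : Fin m → Quad (Set.univ : Set ℂ)), 0 < m → ∃ δ : ℝ, 0 < δ ∧ δ ≤ 1 / 4 ∧ ∀ vlo vhi : ℝ, 0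
    < vlo → vlo < vhi → vhi < 1 → ∃ Θ η₁ : ℝ, 0 ≤ Θ ∧ 0 < η₁ ∧ ∀ η ∈ Set.Ioo 0 η₁, ∀ c ∈ Set.Icc (0
    : ℝ) 1, ∀ ρ ∈ Set.Icc (1 - 2 * δ) 1, P k m F η ρ c ∈ Set.Icc vlo vhi → Dρ k m F η (ρ, c) ≠ 0 ∧ ∀
    S' : ℝ, HasDerivWithinAt (fun r => Dc k m F η (r, c) / Dρ k m F η (r, c)) S' (Set.Icc 0 1) ρ →
    |S'| ≤ Θ) → (∀ k : ℕ, k = 2 ∨ k = 3 → ∀ (m : ℕ) (F : Fin m → Quad (Set.univ : Set ℂ)), 0 < m → ∀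
    vlo vhi : ℝ, 0 < vlo → vlo < vhi → vhi < 1 → ∃ Λ η₁ : ℝ, 0 < η₁ ∧ ∀ η ∈ Set.Ioo 0 η₁, ∀ q ∈
    Set.Icc (0 : ℝ) 1 ×ˢ Set.Icc (0 : ℝ) 1, ∀ q' ∈ Set.Icc (0 : ℝ) 1 ×ˢ Set.Icc (0 : ℝ) 1, (q.1 = 1
    ∨ q.2 = 0) → (q'.1 = 1 ∨ q'.2 = 0) → P k m F η q.1 q.2 ∈ Set.Icc vlo vhi → P k m F η q'.1 q'.2 ∈
    Set.Icc vlo vhi → |Dρ k m F η q| ≤ Λ * |Dρ k m F η q'|) → ∀ k : ℕ, k = 2 ∨ k = 3 → ∀ γ :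
    unitInterval → ℝ × ℝ, PathOK k γ → ∀ (m : ℕ) (F : Fin m → Quad (Set.univ : Set ℂ)), 0 < m → (∀ δ
    : ℝ, 0 < δ → δ ≤ 1 / 2 → ∀ vlo vhi : ℝ, 0 < vlo → vlo < vhi → vhi < 1 → ∃ Λ η₁ : ℝ, 0 < η₁ ∧ ∀ η
    ∈ Set.Ioo 0 η₁, ∀ ρ₀ ∈ Set.Icc (0 : ℝ) (1 - δ), ∀ c₀ ∈ Set.Icc (0 : ℝ) 1, ∀ ρ₁ ∈ Set.Icc (0 : ℝ)
    (1 - δ), ∀ c₁ ∈ Set.Icc (0 : ℝ) 1, P k m F η ρ₀ c₀ ∈ Set.Icc vlo vhi → P k m F η ρ₁ c₁ = P k m F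
    η ρ₀ c₀ → Dc k m F η (ρ₁, c₁) ≤ Λ * Dc k m F η (ρ₀, c₀)) ∧ (∃ δ : ℝ, 0 < δ ∧ δ ≤ 1 / 4 ∧ ∀ vlo
    vhi : ℝ, 0 < vlo → vlo < vhi → vhi < 1 → ∃ Λ η₁ : ℝ, 0 < η₁ ∧ ∀ η ∈ Set.Ioo 0 η₁, ∀ ρ₀ ∈ Set.Icc
    (1 - 2 * δ) 1, ∀ c₀ ∈ Set.Icc (0 : ℝ) 1, ∀ ρ₁ ∈ Set.Icc (1 - 2 * δ) 1, ∀ c₁ ∈ Set.Icc (0 : ℝ) 1,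
    P k m F η ρ₀ c₀ ∈ Set.Icc vlo vhi → P k m F η ρ₁ c₁ = P k m F η ρ₀ c₀ → |Dρ k m F η (ρ₁, c₁)| ≤
    Λ * |Dρ k m F η (ρ₀, c₀)|) := by
  intro hBET hCBW hCP k hk γ hγ m F hm
  exact ⟨levelSetTransport_bulk hBET k hk γ hγ m F hm,
    levelSetTransport_corner_of_pointwise hCBW hCP k hk γ hγ m F hm⟩

end Summit.CriticalPhenomena.CardyFormulaZ2.Theorems.CardySelfRefinement

end
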